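import Mathlib.RingTheory.PowerSeries.Order
import Mathlib.LinearAlgebra.Dimension.StrongRankCondition
import Mathlib.LinearAlgebra.LinearIndependent.Lemmas
import Mathlib.Data.Fin.Tuple.Basic
import Mathlib.Tactic
import HarnessLib

/-!
# The basic arithmetic holonomy bound, II: vanishing-filtration jumps

Calegari–Dimitrov–Tang, arXiv:2408.15403, **Appendix §17.1 "Evaluation module"** (p. 129): for a
`ℚ(x)`-linearly independent `m`-tuple `f₁,…,f_m ∈ ℚ⟦x⟧` the evaluation map
`ψ_D : ℤ[x]^{⊕m}_{deg<D} → ℚ⟦x⟧`, `(Qᵢ) ↦ Σ Qᵢfᵢ`, is injective, and the *vanishing filtration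
jumps* `r_D^{(n)} ∈ {0,1}` (eq. (filtration jumps)) sum to `mD` (eq. (rank sum)), so that "there is
a size-`mD` set of possible `x = 0` vanishing orders `0 ≤ u(1) < u(2) < ⋯ < u(mD)`"
(eq. (jumps)). Abstractly: **the non-zero elements of an `N`-dimensional subspace of `K⟦x⟧`
attain exactly `N` distinct `x`-adic orders.**

This file proves that statement for the span of any linearly independent finite family in
`K⟦x⟧` over a field `K`:

* `HolonomyBound.linearIndependent_of_order_injective` — non-zero power series with pairwise
  distinct orders are linearly independent (look at the lowest order present in a relation);
  this gives `≤ N` orders.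
* `HolonomyBound.exists_distinct_orders` — Gaussian elimination at the minimal order: the span
  of `N` independent series contains `N` non-zero series with pairwise distinct orders
  (`≥ N` orders).
* `HolonomyBound.exists_strictMono_orders` — the enumeration `u : Fin N → ℕ`, strictly
  increasing, of *all* the orders attained by non-zero elements of the span (CDT's
  `u(1) < ⋯ < u(mD)`).

No named facts (everything is proved). The counting lemmas are in `HolonomyBoundCounting.lean`;
the analytic estimate and the assembly of the bound follow in the sequel files.

## References

* [CalegariDimitrovTang2024] arXiv:2408.15403, Appendix §17.1, eqs. (filtration jumps),
  (rank sum), (jumps) (p. 129).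
-/

open Finset PowerSeries

namespace Literature.NumberTheory.Transcendental

namespace HolonomyBound

variable {K : Type*} [Field K]

/-! ### Distinct orders force linear independence -/

/-- A non-zero power series has order `↑(order.toNat)`, and its coefficient there is non-zero;
below the order all coefficients vanish. If moreover the coefficient at `n₀ ≤ order.toNat`
vanishes then `n₀ < order.toNat`. [folklore] -/
theorem lt_order_toNat_of_coeff_eq_zero {w : PowerSeries K} (hw : w ≠ 0) {n₀ : ℕ}
    (hle : n₀ ≤ w.order.toNat) (hcoeff : coeff n₀ w = 0) : n₀ < w.order.toNat := by
  rcases hle.eq_or_lt with h | h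
  · exfalso
    have := coeff_order hw
    rw [← h] at this
    exact this hcoeff
  · exact h

/-- **Distinct orders ⟹ linear independence**: a family of non-zero power series over a field
with pairwise distinct `x`-adic orders is linearly independent (apply `coeff n₀` to a relation,
`n₀` the least order carrying a non-zero coefficient). This is the injectivity half of CDT's
"`r_D^{(n)} ∈ {0,1}`" (eq. (filtration jumps)): at most `dim` orders occur.
[cite: CalegariDimitrovTang2024, Appendix §17.1 eq. (filtration jumps) (p. 129)] -/
theorem linearIndependent_of_order_injective {ι : Type*} (w : ι → PowerSeries K)
    (hw0 : ∀ i, w i ≠ 0) (hinj : Function.Injective fun i => (w i).order) :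
    LinearIndependent K w := by
  classical
  rw [linearIndependent_iff']
  intro s c hrel
  by_contra hne
  push Not at hne
  -- the indices with non-zero coefficient, and the one of least order among them
  set s' : Finset ι := s.filter fun i => c i ≠ 0 with hs'
  have hs'ne : s'.Nonempty := by
    obtain ⟨i, hi, hci⟩ := hne
    exact ⟨i, Finset.mem_filter.mpr ⟨hi, hci⟩⟩
  obtain ⟨i₀, hi₀, hmin⟩ := s'.exists_min_image (fun i => (w i).order.toNat) hs'ne
  obtain ⟨hi₀s, hci₀⟩ := Finset.mem_filter.mp hi₀
  set n₀ : ℕ := (w i₀).order.toNat with hn₀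
  -- apply `coeff n₀` to the relation
  have h := congrArg (coeff n₀) hrel
  rw [map_sum, map_zero] at h
  simp only [map_smul, smul_eq_mul] at h
  rw [Finset.sum_eq_single i₀] at h
  · exact (mul_ne_zero hci₀ (coeff_order (hw0 i₀))) h
  · intro i hi hii₀
    by_cases hci : c i = 0
    · rw [hci, zero_mul]
    · -- `order (w i) > n₀`
      have himem : i ∈ s' := Finset.mem_filter.mpr ⟨hi, hci⟩
      have hge : n₀ ≤ (w i).order.toNat := hmin i himem
      have hne' : (w i).order.toNat ≠ n₀ := by
        intro heq
        apply hii₀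
        apply hinj
        change (w i).order = (w i₀).order
        rw [← coe_toNat_order (hw0 i), ← coe_toNat_order (hw0 i₀), heq]
      have hlt : n₀ < (w i).order.toNat := lt_of_le_of_ne hge (Ne.symm hne')
      rw [coeff_of_lt_order_toNat n₀ hlt, mul_zero]
  · intro h0
    exact absurd hi₀s h0

/-! ### Gaussian elimination: `N` distinct orders inside an `N`-dimensional span -/

/-- Orders in a span are at least the minimal order of the generators: if every `v i` has all
coefficients below `n₀` equal to `0`, so does every element of their span. [folklore] -/
theorem coeff_eq_zero_of_mem_span {ι : Type*} {v : ι → PowerSeries K} {n₀ : ℕ}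
    (hv : ∀ i, ∀ k < n₀, coeff k (v i) = 0) {x : PowerSeries K}
    (hx : x ∈ Submodule.span K (Set.range v)) : ∀ k < n₀, coeff k x = 0 := by
  induction hx using Submodule.span_induction with
  | mem y hy =>
    obtain ⟨i, rfl⟩ := hy
    exact hv i
  | zero => intro k _; exact map_zero _
  | add y z _ _ hy hz => intro k hk; rw [map_add, hy k hk, hz k hk, add_zero]
  | smul a y _ hy => intro k hk; rw [map_smul, hy k hk, smul_zero]

/-- A single coefficient vanishing on the generators vanishes on the span. [folklore] -/
theorem coeff_eq_zero_of_mem_span' {ι : Type*} {v : ι → PowerSeries K} {n₀ : ℕ}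
    (hv : ∀ i, coeff n₀ (v i) = 0) {x : PowerSeries K}
    (hx : x ∈ Submodule.span K (Set.range v)) : coeff n₀ x = 0 := by
  induction hx using Submodule.span_induction with
  | mem y hy =>
    obtain ⟨i, rfl⟩ := hy
    exact hv i
  | zero => exact map_zero _
  | add y z _ _ hy hz => rw [map_add, hy, hz, add_zero]
  | smul a y _ hy => rw [map_smul, hy, smul_zero]

/-- **`N` independent series span `N` distinct orders** (Gaussian elimination at the least
order, then induction): the span of a linearly independent family `v : Fin N → K⟦x⟧` contains
`N` non-zero elements with pairwise distinct orders. This is the surjectivity half of CDT's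
count `Σₙ r_D^{(n)} = mD` (eq. (rank sum)).
[cite: CalegariDimitrovTang2024, Appendix §17.1 eqs. (rank sum), (jumps) (p. 129)] -/
theorem exists_distinct_orders :
    ∀ (N : ℕ) (v : Fin N → PowerSeries K), LinearIndependent K v →
      ∃ w : Fin N → PowerSeries K, (∀ p, w p ∈ Submodule.span K (Set.range v)) ∧
        (∀ p, w p ≠ 0) ∧ Function.Injective fun p => (w p).order := by
  intro N
  induction N with
  | zero =>
    intro v _
    exact ⟨Fin.elim0, fun p => Fin.elim0 p, fun p => Fin.elim0 p, fun p => Fin.elim0 p⟩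
  | succ N ih =>
    intro v hv
    classical
    have hv0 : ∀ i, v i ≠ 0 := fun i => hv.ne_zero i
    -- the generator of least order
    obtain ⟨i₀, -, hmin⟩ :=
      (Finset.univ : Finset (Fin (N + 1))).exists_min_image (fun i => (v i).order.toNat)
        Finset.univ_nonempty
    set n₀ : ℕ := (v i₀).order.toNat with hn₀
    have hmin' : ∀ i, n₀ ≤ (v i).order.toNat := fun i => hmin i (Finset.mem_univ i)
    have hc₀ : coeff n₀ (v i₀) ≠ 0 := coeff_order (hv0 i₀)
    -- eliminate the `n₀`-coefficient from the other generators
    let lam : Fin N → K := fun j => coeff n₀ (v (i₀.succAbove j)) / coeff n₀ (v i₀)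
    let v' : Fin N → PowerSeries K := fun j => v (i₀.succAbove j) - lam j • v i₀
    have hv'coeff : ∀ j, coeff n₀ (v' j) = 0 := by
      intro j
      simp only [v', lam, map_sub, map_smul, smul_eq_mul]
      field_simp
      ring
    have hv'low : ∀ j, ∀ k < n₀, coeff k (v' j) = 0 := by
      intro j k hk
      simp only [v', map_sub, map_smul, smul_eq_mul]
      rw [coeff_of_lt_order_toNat k (lt_of_lt_of_le hk (hmin' _)),
        coeff_of_lt_order_toNat k (lt_of_lt_of_le hk (hmin' _)), mul_zero, sub_zero]
    have hv'span : ∀ j, v' j ∈ Submodule.span K (Set.range v) := by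
      intro j
      refine Submodule.sub_mem _ (Submodule.subset_span ⟨_, rfl⟩)
        (Submodule.smul_mem _ _ (Submodule.subset_span ⟨_, rfl⟩))
    -- `v'` is still linearly independent
    have hv'ind : LinearIndependent K v' := by
      rw [Fintype.linearIndependent_iff]
      intro d hd j
      -- the relation among the `v i`
      let e : Fin (N + 1) → K := Fin.insertNth i₀ (-(∑ j, d j * lam j)) d
      have he : ∑ i, e i • v i = 0 := by
        rw [Fin.sum_univ_succAbove _ i₀]
        simp only [e, Fin.insertNth_apply_same, Fin.insertNth_apply_succAbove]
        have : ∑ j, d j • v' j = ∑ j, d j • v (i₀.succAbove j) - (∑ j, d j * lam j) • v i₀ := by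
          simp only [v', smul_sub, Finset.sum_sub_distrib, smul_smul, Finset.sum_smul]
        rw [this] at hd
        rw [neg_smul]
        linear_combination hd
      have := (Fintype.linearIndependent_iff.mp hv) e he (i₀.succAbove j)
      simpa only [e, Fin.insertNth_apply_succAbove] using this
    -- induction hypothesis on `v'`
    obtain ⟨w', hw'span, hw'0, hw'inj⟩ := ih v' hv'ind
    have hspan_le : Submodule.span K (Set.range v') ≤ Submodule.span K (Set.range v) :=
      Submodule.span_le.mpr (by rintro _ ⟨j, rfl⟩; exact hv'span j)
    -- the `w' p` have order `> n₀`
    have hw'ord : ∀ p, n₀ < (w' p).order.toNat := by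
      intro p
      have hlow : ∀ k < n₀, coeff k (w' p) = 0 :=
        coeff_eq_zero_of_mem_span hv'low (hw'span p)
      have hle : n₀ ≤ (w' p).order.toNat := by
        have h := nat_le_order (w' p) n₀ hlow
        rw [← coe_toNat_order (hw'0 p)] at h
        exact_mod_cast h
      exact lt_order_toNat_of_coeff_eq_zero (hw'0 p) hle
        (coeff_eq_zero_of_mem_span' hv'coeff (hw'span p))
    -- assemble: `w = (v i₀, w')`
    refine ⟨Fin.cases (v i₀) w', ?_, ?_, ?_⟩
    · intro p
      refine Fin.cases ?_ (fun q => ?_) p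
      · exact Submodule.subset_span ⟨i₀, rfl⟩
      · exact hspan_le (hw'span q)
    · intro p
      refine Fin.cases ?_ (fun q => ?_) p
      · exact hv0 i₀
      · exact hw'0 q
    · intro p q hpq
      induction p using Fin.cases with
      | zero =>
        induction q using Fin.cases with
        | zero => rfl
        | succ q =>
          exfalso
          simp only [Fin.cases_zero, Fin.cases_succ] at hpq
          have h1 : (v i₀).order.toNat = (w' q).order.toNat := by
            rw [← ENat.coe_inj, coe_toNat_order (hv0 i₀), coe_toNat_order (hw'0 q), hpq]
          exact absurd (hw'ord q) (by rw [← h1]; exact lt_irrefl _)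
      | succ p =>
        induction q using Fin.cases with
        | zero =>
          exfalso
          simp only [Fin.cases_zero, Fin.cases_succ] at hpq
          have h1 : (w' p).order.toNat = (v i₀).order.toNat := by
            rw [← ENat.coe_inj, coe_toNat_order (hv0 i₀), coe_toNat_order (hw'0 p), hpq]
          exact absurd (hw'ord p) (by rw [h1]; exact lt_irrefl _)
        | succ q =>
          simp only [Fin.cases_succ] at hpq
          rw [hw'inj hpq]

/-! ### The enumeration of the attained orders -/

/-- **The vanishing-filtration jumps** (CDT eq. (jumps): "a size-`mD` set of possible `x = 0`
vanishing orders `0 ≤ u(1) < u(2) < ⋯ < u(mD)`"): for a linearly independent finite family `v`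
in `K⟦x⟧` there is a strictly increasing enumeration `u : Fin (card ι) → ℕ` of exactly the orders
of the non-zero elements of `span v`.
[cite: CalegariDimitrovTang2024, Appendix §17.1 eq. (jumps) (p. 129)] -/
theorem exists_strictMono_orders {ι : Type*} [Fintype ι] (v : ι → PowerSeries K)
    (hv : LinearIndependent K v) :
    ∃ u : Fin (Fintype.card ι) → ℕ, StrictMono u ∧
      (∀ p, ∃ w ∈ Submodule.span K (Set.range v), w ≠ 0 ∧ w.order = u p) ∧
      (∀ w ∈ Submodule.span K (Set.range v), w ≠ 0 → ∃ p, w.order = u p) := by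
  classical
  set N := Fintype.card ι with hN
  -- reindex by `Fin N`
  let eqv : ι ≃ Fin N := Fintype.equivFin ι
  let v₀ : Fin N → PowerSeries K := v ∘ eqv.symm
  have hv₀ : LinearIndependent K v₀ := hv.comp _ eqv.symm.injective
  have hrange : Set.range v₀ = Set.range v := eqv.symm.surjective.range_comp v
  obtain ⟨w, hwspan, hw0, hwinj⟩ := exists_distinct_orders N v₀ hv₀
  rw [hrange] at hwspan
  -- the finset of attained orders of the `w p`
  set O : Finset ℕ := Finset.univ.image fun p => (w p).order.toNat with hO
  have hOinj : Function.Injective fun p => (w p).order.toNat := by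
    intro p q hpq
    apply hwinj
    change (w p).order = (w q).order
    rw [← coe_toNat_order (hw0 p), ← coe_toNat_order (hw0 q)]
    exact_mod_cast hpq
  have hOcard : O.card = N := by
    rw [hO, Finset.card_image_of_injective _ hOinj, Finset.card_univ, Fintype.card_fin]
  refine ⟨fun p => O.orderEmbOfFin hOcard p, (O.orderEmbOfFin hOcard).strictMono, ?_, ?_⟩
  · intro p
    have hmem : O.orderEmbOfFin hOcard p ∈ O := Finset.orderEmbOfFin_mem O hOcard p
    obtain ⟨q, -, hq⟩ := Finset.mem_image.mp hmem
    refine ⟨w q, hwspan q, hw0 q, ?_⟩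
    rw [← coe_toNat_order (hw0 q), hq]
  · intro x hx hx0
    -- the order of `x` is one of the `N` orders, else `N + 1` independent vectors in the span
    set n : ℕ := x.order.toNat with hn
    suffices hmem : n ∈ O by
      have : n ∈ Set.range (O.orderEmbOfFin hOcard) := by
        rw [Finset.range_orderEmbOfFin]; exact hmem
      obtain ⟨p, hp⟩ := this
      exact ⟨p, by rw [← coe_toNat_order hx0, ← hn, ← hp]⟩
    by_contra hnot
    -- the extended family
    let wx : Fin (N + 1) → PowerSeries K := Fin.cases x w
    have hwx0 : ∀ p, wx p ≠ 0 := fun p => by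
      refine Fin.cases ?_ (fun q => ?_) p
      · exact hx0
      · exact hw0 q
    have hwxinj : Function.Injective fun p => (wx p).order := by
      intro p q hpq
      induction p using Fin.cases with
      | zero =>
        induction q using Fin.cases with
        | zero => rfl
        | succ q =>
          exfalso
          apply hnot
          simp only [wx, Fin.cases_zero, Fin.cases_succ] at hpq
          have : n = (w q).order.toNat := by
            rw [hn, ← ENat.coe_inj, coe_toNat_order hx0, coe_toNat_order (hw0 q), hpq]
          rw [this]
          exact Finset.mem_image.mpr ⟨q, Finset.mem_univ _, rfl⟩
      | succ p =>
        induction q using Fin.cases with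
        | zero =>
          exfalso
          apply hnot
          simp only [wx, Fin.cases_zero, Fin.cases_succ] at hpq
          have : n = (w p).order.toNat := by
            rw [hn, ← ENat.coe_inj, coe_toNat_order hx0, coe_toNat_order (hw0 p), hpq]
          rw [this]
          exact Finset.mem_image.mpr ⟨p, Finset.mem_univ _, rfl⟩
        | succ q =>
          simp only [wx, Fin.cases_succ] at hpq
          rw [hwinj hpq]
    have hind : LinearIndependent K wx := linearIndependent_of_order_injective wx hwx0 hwxinj
    have hsub : Set.range wx ≤ (Submodule.span K (Set.range v₀) : Set (PowerSeries K)) := by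
      rintro _ ⟨p, rfl⟩
      rw [hrange]
      refine Fin.cases ?_ (fun q => ?_) p
      · exact hx
      · exact hwspan q
    have hcard := linearIndependent_le_span_aux' wx hind (Set.range v₀) hsub
    rw [Fintype.card_fin] at hcard
    have hle : Fintype.card (Set.range v₀) ≤ N := by
      calc Fintype.card (Set.range v₀) ≤ Fintype.card (Fin N) := Fintype.card_range_le v₀
        _ = N := Fintype.card_fin N
    omega

end HolonomyBound

end Literature.NumberTheory.Transcendental
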